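import Summits.AtomisticToContinuum.Crystallization.Theorems.ChartedZeroExcessLayeredLatticeLiouvilleZZZYRCZ

/-!
# Charted zero-excess layered-lattice Liouville — ZZZYRCZK: ★★ `thetaReaderNear_holds` (the θ⁰ near reader contract HOLDS)

Cell `decomp-a2c`, lens 2, generation 100.  Line (D) TAIL-DEBIT of `UniformEquilStabilityAt`, NEAR class of the three-way cover: the
contract `ThetaReaderNear` of ZZZYRCX is PROVED from the kit ZZZYRCZ.  PATH SYSTEM: a far ideal-near pair `x` is listed
(`lookup_of_near`), its path is the translate of the datum's chord path, endpoints by construction, and every piece has ideal length in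
`(0, P9max]`, hence actual length in `(0, ϱ]` by `λ²·n9 ≤ 9‖e‖² ≤ μ²·n9 ≤ μ²·P9max ≤ 9ϱ²`.  DOMINATION: for a finite set `X` of far
ideal-near pairs and a pair `y`, the counting lemma `sum_pieces_le_table` with the per-incidence bounds of RCZ §4 gives
`Σ_{x∈X} Σ_i [pieceᵢ(x) = y]·schemeCoefR ≤ (1+α)λ⁻⁸·thetaR0 (key y) ≤ (1+α)λ⁻⁸·TR (key y)` and the N analogue with
`K·thetaN0 + η·thetaR0 ≤ K·TN + η·TR` (`K, η ≥ 0`).  With this file the NEAR class of `boxSchemeP_of_cover3` (ZZZYRCY) is reduced to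
hand-1's kernel contract `KernelSlabSound` (decode of `slabAcc_sound`, ZZZYRCXL) per θ⁰ slab file and the box comparisons.

Theorem file (3 theorems); imports ZZZYRCZ; no instance / notation / option; 0 sorry. [g100]
-/

namespace Summit.AtomisticToContinuum.Crystallization.Theorems.ChartedZeroExcessLayeredLatticeLiouville

open scoped BigOperators RealInnerProductSpace
open Summit.AtomisticToContinuum.Crystallization.Theorems.ChartedPlanarOrderRigidityDoor (E3)

/-! ### §5 the contract -/

/-- the key-indexed R-table of the counting lemma is `(1+α)λ⁻⁸·thetaR0`. [g100] -/
theorem tableR_eq {wd : List ℤ} {cd : List ChordDatum} (hnd : cd.Nodup) (κ : ℝ) (k : ℤ × ℤ × ℤ × ℤ) :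
    (∑ c ∈ cd.toFinset, ∑ i ∈ Finset.range (chordNp c),
        if pieceKeyW wd.length (chordPiece c i) = k then κ * coefR0 wd c else 0) = κ * thetaR0 wd cd k := by
  unfold thetaR0
  rw [← List.sum_toFinset _ hnd, Finset.mul_sum]
  refine Finset.sum_congr rfl fun c _ => ?_
  rw [Finset.mul_sum]
  refine Finset.sum_congr rfl fun i _ => ?_
  split_ifs
  · rfl
  · rw [mul_zero]

/-- the key-indexed N-table of the counting lemma is `(1+α⁻¹)λ⁻⁸·(K·thetaN0 + η·thetaR0)`. [g100] -/
theorem tableN_eq {wd : List ℤ} {cd : List ChordDatum} (hnd : cd.Nodup) (κ K η : ℝ) (k : ℤ × ℤ × ℤ × ℤ) :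
    (∑ c ∈ cd.toFinset, ∑ i ∈ Finset.range (chordNp c),
        if pieceKeyW wd.length (chordPiece c i) = k then κ * (K * coefN0 wd c i + η * coefR0 wd c) else 0) =
      κ * (K * thetaN0 wd cd k + η * thetaR0 wd cd k) := by
  unfold thetaN0 thetaR0
  rw [← List.sum_toFinset _ hnd, ← List.sum_toFinset _ hnd, Finset.mul_sum, Finset.mul_sum, ← Finset.sum_add_distrib,
    Finset.mul_sum]
  refine Finset.sum_congr rfl fun c _ => ?_
  rw [Finset.mul_sum, Finset.mul_sum, ← Finset.sum_add_distrib, Finset.mul_sum]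
  refine Finset.sum_congr rfl fun i _ => ?_
  split_ifs
  · ring
  · ring

/-- ★★ THE NEAR READER CONTRACT HOLDS. [g100] -/
theorem thetaReaderNear_holds : ThetaReaderNear := by
  intro wd lo hi P9max cd TR TN ϱ α lam mu K η a b w hp hϱ hα hlam hK hη hV hTR hTN _ hL hA hP9 hlo
  have key : ∀ x : (Cell 2 × ℤ) × (Cell 2 × ℤ), ϱ < ‖bondVec a b w x‖ → IdealNear wd hi x →
      ∃ c ∈ cd, dataLookup wd.length cd x = some c :=
    fun x hx hN => lookup_of_near hp hV (lo_lt_n9W_of_far hϱ hL hlo hx) hN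
  constructor
  · intro x hx hN
    obtain ⟨c, hc, hcx⟩ := key x hx hN
    have hc1 : c.1 = toBase wd.length x := (lookup_sound hcx).2
    have hxe : shiftPairW x.1.1 (baseShift wd.length x) c.1 = x := by rw [hc1, shiftPairW_toBase]
    refine ⟨?_, ?_, ?_⟩
    · rw [dataZ_of_lookup hcx, chordNodes_getD_zero]
      exact congrArg Prod.fst hxe
    · rw [dataNp_of_lookup hcx, dataZ_of_lookup hcx, chordNodes_getD_np]
      exact congrArg Prod.snd hxe
    · intro i hi
      rw [dataNp_of_lookup hcx] at hi
      rw [piece_dataZ hcx]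
      have hpc := (hV.1 c hc).2.2.2.2.2 i hi
      have hn9 : n9W wd (shiftPairW x.1.1 (baseShift wd.length x) (chordPiece c i)) = n9W wd (chordPiece c i) := by
        rw [baseShift_eq]; exact n9W_shiftPairW wd _ _ _
      obtain ⟨h1, h2⟩ := hL (shiftPairW x.1.1 (baseShift wd.length x) (chordPiece c i))
      rw [hn9] at h1 h2
      have hlo1 : (1 : ℝ) ≤ n9W wd (chordPiece c i) := by exact_mod_cast hpc.1
      have hhiP : (n9W wd (chordPiece c i) : ℝ) ≤ P9max := by exact_mod_cast hpc.2
      have hnn := norm_nonneg (bondVec a b w (shiftPairW x.1.1 (baseShift wd.length x) (chordPiece c i)))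
      constructor
      · rcases hnn.eq_or_lt with h0 | hpos
        · exfalso
          rw [← h0] at h1
          nlinarith
        · exact hpos
      · have hsq : ‖bondVec a b w (shiftPairW x.1.1 (baseShift wd.length x) (chordPiece c i))‖ ^ 2 ≤ ϱ ^ 2 := by
          nlinarith [sq_nonneg mu, mul_le_mul_of_nonneg_left hhiP (sq_nonneg mu)]
        exact (pow_le_pow_iff_left₀ hnn hϱ two_ne_zero).mp hsq
  · intro X hX y
    have hnd : cd.Nodup := List.Nodup.of_map _ hV.2.1
    have hlk : ∀ x ∈ X, ∃ c ∈ cd.toFinset, dataLookup wd.length cd x = some c ∧ dataNp wd.length cd x = chordNp c :=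
      fun x hx => by
        obtain ⟨c, hc, hcx⟩ := key x (hX x hx).1 (hX x hx).2
        exact ⟨c, List.mem_toFinset.mpr hc, hcx, dataNp_of_lookup hcx⟩
    have hQ : ∀ (x : (Cell 2 × ℤ) × (Cell 2 × ℤ)) (c : ChordDatum) (i : ℕ), dataLookup wd.length cd x = some c →
        piece (dataZ wd.length cd) x i = y → pieceKeyW wd.length (chordPiece c i) = pieceKeyW wd.length y := by
      intro x c i hcx hP
      rw [piece_dataZ hcx] at hP
      rw [← hP, baseShift_eq, pieceKeyW_shiftPairW]
    have hinj : ∀ x ∈ X, ∀ x' ∈ X, ∀ (c : ChordDatum) (i : ℕ), dataLookup wd.length cd x = some c →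
        dataLookup wd.length cd x' = some c → piece (dataZ wd.length cd) x i = y → piece (dataZ wd.length cd) x' i = y →
        x = x' := by
      intro x _ x' _ c i hx hx' hP hP'
      rw [piece_dataZ hx] at hP
      rw [piece_dataZ hx'] at hP'
      have h1 : shiftSiteW x.1.1 (baseShift wd.length x) (chordPiece c i).1 =
          shiftSiteW x'.1.1 (baseShift wd.length x') (chordPiece c i).1 := congrArg Prod.fst (hP.trans hP'.symm)
      obtain ⟨hγ, hd⟩ := shiftSiteW_inj h1
      rw [← shiftPairW_toBase wd.length x, ← shiftPairW_toBase wd.length x', ← (lookup_sound hx).2, ← (lookup_sound hx').2,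
        hγ, hd]
    have hR := sum_pieces_le_table X cd.toFinset (dataNp wd.length cd) chordNp (dataLookup wd.length cd)
      (fun x i => piece (dataZ wd.length cd) x i = y)
      (fun c i => pieceKeyW wd.length (chordPiece c i) = pieceKeyW wd.length y)
      (schemeCoefR α a b w (dataNp wd.length cd) (dataZ wd.length cd)) (fun c _ => (1 + α) * (lam ^ 8)⁻¹ * coefR0 wd c) hlk
      (fun x hx c i hcx _ hP => ⟨schemeCoefR_le_coefR0 hϱ hα hlam hL (hX x hx).1 hcx i, hQ x c i hcx hP⟩)
      (fun c _ i _ _ => by unfold coefR0; positivity) hinj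
    have hN := sum_pieces_le_table X cd.toFinset (dataNp wd.length cd) chordNp (dataLookup wd.length cd)
      (fun x i => piece (dataZ wd.length cd) x i = y)
      (fun c i => pieceKeyW wd.length (chordPiece c i) = pieceKeyW wd.length y)
      (schemeCoefN α a b w (dataNp wd.length cd) (dataZ wd.length cd))
      (fun c i => (1 + α⁻¹) * (lam ^ 8)⁻¹ * (K * coefN0 wd c i + η * coefR0 wd c)) hlk
      (fun x hx c i hcx hi hP => ⟨schemeCoefN_le_coefN0 hϱ hα hlam hL hA hV (hX x hx).1 hcx hi, hQ x c i hcx hP⟩)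
      (fun c hc i hi _ => mul_nonneg (by positivity) (coefN_table_nonneg hA hV (List.mem_toFinset.mp hc) hi)) hinj
    rw [tableR_eq hnd] at hR
    rw [tableN_eq hnd] at hN
    constructor
    · exact hR.trans (mul_le_mul_of_nonneg_left (hTR _) (by positivity))
    · refine hN.trans (mul_le_mul_of_nonneg_left ?_ (by positivity))
      exact add_le_add (mul_le_mul_of_nonneg_left (hTN _) hK) (mul_le_mul_of_nonneg_left (hTR _) hη)

end Summit.AtomisticToContinuum.Crystallization.Theorems.ChartedZeroExcessLayeredLatticeLiouville
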